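import Literature.NumberTheory.Kottwitz1992.ModuliProblemHolds                       -- ★ `isSimpleRing_C`, `center_C_map_val`, `rho_mem_C_iff`
import Literature.RingTheory.CentralSimple.PositiveInvolutionSecondKindRealStructure  -- ★ Lange Thm. 2.6.5/2.6.8: `exists_algEquiv_pi_matrix`
import Literature.RingTheory.CentralSimple.CentralizerCornerDimensions               -- ★ `isSquare_finrank_of_isCentral`: `[C:F]` is a square
import Literature.NumberTheory.NumberFields.PositiveInvolution                        -- ★ Shimura §5.1 Lemma 2: `isTotallyComplex_of_trace_mul_nonneg`
import Mathlib.RingTheory.SimpleRing.Field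
import Mathlib.FieldTheory.IsAlgClosed.Basic
import Mathlib.Algebra.Module.LinearMap.Rat
import HarnessLib

/-!
# [Kottwitz1992, §5 p. 391 (5.h)] «in Case A `C_ℝ` is a product of `[F₀ : ℚ]` copies of `M_n(ℂ)`» — DISCHARGED:
# `Kottwitz1992_5_CR_caseA_holds`

Kernel-lane companion of the statement carpet ★ `Literature/NumberTheory/Kottwitz1992/ModuliProblem.lean` (squad TK; precedents ★
`ModuliProblemHolds`, ★ `ModuliProblemMEvenHolds`, ★ `ModuliProblemCasesHolds`): the named fact ★ `ModuliProblem.Kottwitz1992_5_CR_caseA` —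
for the rational PEL datum `(B, *, V, ⟨·,·⟩, h)` of §5 in Case A (`*` of the second kind) the commutant `C = End_B(V)` satisfies
`dim_ℚ C = n² [F : ℚ]` and `C_ℝ = ℝ ⊗_ℚ C ≃ₐ[ℝ] ∏_{[F₀ : ℚ]} M_n(ℂ)` for some `n ≥ 1` — is PROVED here as
`theorem Kottwitz1992_5_CR_caseA_holds : Kottwitz1992_5_CR_caseA`.  THEOREMS ONLY (no definition, no named fact, no `sorry`, no
instance, no notation); cell hodgecm-mathlib, seat B-typ04 (g32); net debt −1.

R. E. Kottwitz, *Points on some Shimura varieties over finite fields*, J. Amer. Math. Soc. 5 (1992), §5 p. 391 L41–L45 (held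
`paper:doi-10-2307-2152772`, p0019).  THE PRINT: «Using that `*` is a positive involution and that our form `⟨·,·⟩` is skew-Hermitian,
one sees easily that […] of course in Case A it is a product of `[F₀ : ℚ]` copies of `M_n(ℂ)`» (`m = [F : F₀] n = 2n`, `n² [F : ℚ] =
dim_ℚ C`).  No proof is printed; THE PROOF GIVEN HERE (standard, through the tree's libraries): §1 the centre `F = Z(B)` of the simple
ring `B` is a field over which `B` is a finite algebra, and `*` restricts to a ring automorphism `σ` of `F` (the centre is `*`-stable)
whose trace form is non-negative — `tr_{B/ℚ}(L_{x x*}) = [B : F] · tr_{F/ℚ}(x σx) > 0` (transitivity of the trace) — and `σ ≠ id`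
in Case A; §2 hence `F` is totally imaginary (the tree's ★ Shimura §5.1 Lemma 2,
`Literature.NumberTheory.NumberFields.isTotallyComplex_of_trace_mul_nonneg`), read on a `Type`-small copy `K ⊆ ℂ` of `F` (the image of
a complex embedding; the real-structure engine below is stated for number fields in `Type`), and `[F : ℚ] = 2 [F₀ : ℚ]` (multiplication
by a non-zero `*`-antisymmetric central element exchanges the `*`-symmetric and `*`-antisymmetric parts of `F`); §3 `C = End_B(V)` is
simple with centre `ρ(F)` (★ `ModuliProblemHolds.isSimpleRing_C`, ★ `center_C_map_val`, Kottwitz p. 389), so `C` is a finite-dimensional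
CENTRAL simple `K`-algebra through `K ≅ F → C`, of square degree `[C : F] = n²` (★ `Literature.RingTheory.CentralSimple.isSquare_finrank_of_isCentral`);
§4 the tree's type-IV real-structure theorem ★ `Literature.RingTheory.CentralSimple.exists_algEquiv_pi_matrix` (Lange 2023 Thm. 2.6.5
proof Step II + Thm. 2.6.8: `ℝ ⊗_ℚ C ≃ₐ[ℝ] ∏_{w ∣ ∞} M_n(ℂ)` for `C` central simple over a totally complex number field, the product
over its `½[K : ℚ] = [F₀ : ℚ]` infinite places, ★ `two_mul_card_infinitePlace_eq_finrank`), reindexed by `Fin [F₀ : ℚ]`.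
HONEST LABEL: HC_CM is proved only modulo the 7 printed citations (2 remaining: hLiu418, h413) until rung 0 closes; this file adds no citation
debt (0 facts, 0 sorry) and discharges 1 named fact of ★ `ModuliProblem`.

## References
* [Kottwitz1992] R. E. Kottwitz, Points on some Shimura varieties over finite fields, J. Amer. Math. Soc. 5 (1992) 373–444, §5 p. 391.
* [Lange2023AbelianVarietiesComplex] H. Lange, Abelian Varieties over the Complex Numbers (2023), §2.6.2 Thm. 2.6.5, Thm. 2.6.8 (the tree's
  `PositiveInvolutionSecondKindRealStructure`).
* [Shimura1998] G. Shimura, Abelian Varieties with Complex Multiplication and Modular Functions, §5.1 Lemma 2 (the tree's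
  `NumberFields/PositiveInvolution`).
-/

noncomputable section

namespace Literature.NumberTheory.Kottwitz1992.ModuliProblem

open scoped TensorProduct
open Module NumberField
open Literature.NumberTheory.Kottwitz1992.ModuliProblemHolds
open Literature.RingTheory.CentralSimple

universe u v

/-- The centre of a `*`-ring is `*`-stable. [folklore] -/
private theorem star_mem_center {B : Type u} [Ring B] [Algebra ℚ B] [StarRing B] {z : B} (hz : z ∈ Subalgebra.center ℚ B) :
    star z ∈ Subalgebra.center ℚ B := by
  rw [Subalgebra.mem_center_iff] at hz ⊢
  intro b
  have h := congrArg star (hz (star b))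
  rw [star_mul, star_mul, star_star] at h
  exact h.symm

/-- **`[F : ℚ] = 2 [F₀ : ℚ]` in Case A**: for a finite-dimensional simple `ℚ`-algebra `B` whose involution `*` moves a central element,
the `*`-fixed part `F₀ = F ∩ Sym(B, *)` of the centre `F` has half the dimension of `F` (multiplication by a non-zero `*`-antisymmetric
central element — a unit, `F` being a field — exchanges `F ∩ Sym` and `F ∩ Skew`, and `F = (F ∩ Sym) ⊕ (F ∩ Skew)`). [folklore] -/
private theorem two_mul_finrank_F0 (B : Type u) [Ring B] [Algebra ℚ B] [StarRing B] [StarModule ℚ B] [FiniteDimensional ℚ B]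
    [IsSimpleRing B] (hA : IsCaseA B) : 2 * finrank ℚ (F0 B) = finrank ℚ (Subalgebra.center ℚ B) := by
  classical
  set Zs : Submodule ℚ B := Subalgebra.toSubmodule (Subalgebra.center ℚ B) with hZs
  set P : Submodule ℚ B := Zs ⊓ selfAdjoint.submodule ℚ B with hP
  set N : Submodule ℚ B := Zs ⊓ skewAdjoint.submodule ℚ B with hN
  have hmemP : ∀ x : B, x ∈ P ↔ x ∈ Subalgebra.center ℚ B ∧ star x = x := fun x => by
    rw [hP, Submodule.mem_inf, hZs, Subalgebra.mem_toSubmodule]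
    exact Iff.rfl
  have hmemN : ∀ x : B, x ∈ N ↔ x ∈ Subalgebra.center ℚ B ∧ star x = -x := fun x => by
    rw [hN, Submodule.mem_inf, hZs, Subalgebra.mem_toSubmodule]
    exact Iff.rfl
  -- `F = (F ∩ Sym) ⊕ (F ∩ Skew)`
  have hsup : P ⊔ N = Zs := by
    apply le_antisymm (sup_le inf_le_left inf_le_left)
    intro z hz
    rw [hZs, Subalgebra.mem_toSubmodule] at hz
    have hz' : star z ∈ Subalgebra.center ℚ B := star_mem_center hz
    rw [Submodule.mem_sup]
    refine ⟨(1 / 2 : ℚ) • (z + star z), ?_, (1 / 2 : ℚ) • (z - star z), ?_, ?_⟩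
    · exact P.smul_mem _ ((hmemP _).2 ⟨add_mem hz hz', by rw [star_add, star_star, add_comm]⟩)
    · exact N.smul_mem _ ((hmemN _).2 ⟨sub_mem hz hz', by rw [star_sub, star_star, neg_sub]⟩)
    · rw [← smul_add]
      have : z + star z + (z - star z) = (2 : ℚ) • z := by rw [two_smul]; abel
      rw [this, smul_smul]; norm_num
  have hinf : P ⊓ N = ⊥ := by
    rw [eq_bot_iff]
    intro z hz
    rw [Submodule.mem_inf, hmemP, hmemN] at hz
    have h2 : (2 : ℚ) • z = 0 := by
      rw [two_smul]
      nth_rewrite 2 [← hz.1.2]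
      rw [hz.2.2, add_neg_cancel]
    rw [Submodule.mem_bot]
    exact (smul_eq_zero.1 h2).resolve_left two_ne_zero
  have hdim : finrank ℚ Zs = finrank ℚ P + finrank ℚ N := by
    have h := Submodule.finrank_sup_add_finrank_inf_eq P N
    rw [hsup, hinf, finrank_bot, add_zero] at h
    exact h
  -- a non-zero `*`-antisymmetric central element `y`, a unit of `B`
  obtain ⟨x, hx, hne⟩ := hA
  set y : B := x - star x with hy
  have hy0 : y ≠ 0 := fun h => hne (sub_eq_zero.1 h).symm
  have hyZ : y ∈ Subalgebra.center ℚ B := sub_mem hx (star_mem_center hx)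
  have hystar : star y = -y := by rw [hy, star_sub, star_star, neg_sub]
  have hyc : ∀ b : B, b * y = y * b := Subalgebra.mem_center_iff.1 hyZ
  obtain ⟨w, hw⟩ : ∃ w : B, y * w = 1 := by
    have hF := IsSimpleRing.isField_center B
    have hy' : (⟨y, Subring.mem_center_iff.2 hyc⟩ : Subring.center B) ≠ 0 := fun h => hy0 (congrArg Subtype.val h)
    obtain ⟨w, hw⟩ := hF.mul_inv_cancel hy'
    exact ⟨w, congrArg Subtype.val hw⟩
  have hcancel : ∀ b : B, y * b = 0 → b = 0 := fun b hb => by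
    rw [← one_mul b, ← hw, ← hyc w, mul_assoc, hb, mul_zero]
  -- `b ↦ y b` maps `F ∩ Sym` into `F ∩ Skew` and back, injectively
  have hPN : ∀ p ∈ P, y * p ∈ N := fun p hp => by
    rw [hmemP] at hp
    exact (hmemN _).2 ⟨Subalgebra.mul_mem _ hyZ hp.1, by rw [star_mul, hp.2, hystar, mul_neg, hyc]⟩
  have hNP : ∀ n ∈ N, y * n ∈ P := fun n hn => by
    rw [hmemN] at hn
    exact (hmemP _).2 ⟨Subalgebra.mul_mem _ hyZ hn.1, by rw [star_mul, hn.2, hystar, neg_mul_neg, hyc]⟩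
  let f : P →ₗ[ℚ] N := ((LinearMap.mulLeft ℚ y).comp P.subtype).codRestrict N fun p => hPN p.1 p.2
  let g : N →ₗ[ℚ] P := ((LinearMap.mulLeft ℚ y).comp N.subtype).codRestrict P fun n => hNP n.1 n.2
  have hf : Function.Injective f := fun p q h => by
    apply Subtype.ext
    have h' : y * (p : B) = y * (q : B) := congrArg Subtype.val h
    rw [← sub_eq_zero, ← mul_sub] at h'
    exact sub_eq_zero.1 (hcancel _ h')
  have hg : Function.Injective g := fun p q h => by
    apply Subtype.ext
    have h' : y * (p : B) = y * (q : B) := congrArg Subtype.val h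
    rw [← sub_eq_zero, ← mul_sub] at h'
    exact sub_eq_zero.1 (hcancel _ h')
  have h1 : finrank ℚ P ≤ finrank ℚ N := LinearMap.finrank_le_finrank_of_injective hf
  have h2 : finrank ℚ N ≤ finrank ℚ P := LinearMap.finrank_le_finrank_of_injective hg
  rw [← Subalgebra.finrank_toSubmodule, ← hZs, hdim]
  change 2 * finrank ℚ P = finrank ℚ P + finrank ℚ N
  omega

/-- **§5 (5.h), Case A, PROVED**: ★ `Kottwitz1992_5_CR_caseA` holds — for the rational PEL datum of §5 with `*` of the second kind,
`dim_ℚ C = n² [F : ℚ]` and `C_ℝ = ℝ ⊗_ℚ End_B(V) ≃ₐ[ℝ] ∏_{[F₀ : ℚ]} M_n(ℂ)` with `n ≥ 1` (see the module docstring for the proof).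
[cite: Kottwitz1992, §5 (p. 391)] -/
theorem Kottwitz1992_5_CR_caseA_holds : Kottwitz1992_5_CR_caseA.{u, v} := by
  intro B _ _ _ _ V _ _ D hA
  haveI := D.isSimpleRing
  haveI := D.finiteDimensional
  haveI := D.finiteDimensionalV
  haveI := D.nontrivialV
  classical
  /- §1 the centre `F = Z(B)` is a field over which `B` is a finite algebra; `*` restricts to a ring automorphism `σ` of `F` with
  non-negative trace form, `σ ≠ id` (the `ℚ`-structure of `F` is the subalgebra one throughout) -/
  set Z : Subalgebra ℚ B := Subalgebra.center ℚ B with hZdef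
  have hZ : IsField Z :=
    MulEquiv.isField (IsSimpleRing.isField_center B)
      ({ toFun := fun x => ⟨x.1, Subring.mem_center_iff.2 (Subalgebra.mem_center_iff.1 x.2)⟩
         invFun := fun x => ⟨x.1, Subalgebra.mem_center_iff.2 (Subring.mem_center_iff.1 x.2)⟩
         left_inv := fun _ => rfl
         right_inv := fun _ => rfl
         map_mul' := fun _ _ => rfl } : Z ≃* Subring.center B)
  letI : Field Z := hZ.toField
  letI : Algebra Z B := Algebra.ofModule
    (fun c x y => by rw [Subalgebra.smul_def, Subalgebra.smul_def, smul_eq_mul, smul_eq_mul, mul_assoc])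
    (fun c x y => by
      rw [Subalgebra.smul_def, Subalgebra.smul_def, smul_eq_mul, smul_eq_mul, ← mul_assoc, Subalgebra.mem_center_iff.1 c.2 x,
        mul_assoc])
  have halg : ∀ c : Z, algebraMap Z B c = (c : B) := fun c => by
    rw [Algebra.algebraMap_eq_smul_one, Subalgebra.smul_def, smul_eq_mul, mul_one]
  haveI : IsScalarTower ℚ Z B := ⟨fun r c a => by
    rw [Subalgebra.smul_def, Subalgebra.smul_def, Subalgebra.coe_smul, smul_eq_mul, smul_eq_mul, smul_mul_assoc]⟩
  haveI : Module.Finite Z B := Module.Finite.of_restrictScalars_finite ℚ Z B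
  haveI : FiniteDimensional ℚ Z := Module.Finite.of_injective Z.val.toLinearMap Subtype.val_injective
  have hBZ : 0 < finrank Z B := finrank_pos
  -- `*` on the centre
  let σ : Z →+* Z :=
    { toFun := fun z => ⟨star (z : B), star_mem_center z.2⟩
      map_one' := Subtype.ext (by simp)
      map_mul' := fun a b => Subtype.ext (by
        change star ((a : B) * (b : B)) = star (a : B) * star (b : B)
        rw [star_mul, Subalgebra.mem_center_iff.1 (star_mem_center a.2)])
      map_zero' := Subtype.ext (by simp)
      map_add' := fun a b => Subtype.ext (by
        change star ((a : B) + (b : B)) = star (a : B) + star (b : B)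
        rw [star_add]) }
  have hσ : ∀ z : Z, ((σ z : Z) : B) = star (z : B) := fun _ => rfl
  -- `tr_{B/ℚ}(L_w) = [B : F] · tr_{F/ℚ}(w)` for central `w`
  have htrB : ∀ w : Z, LinearMap.trace ℚ B (LinearMap.mulLeft ℚ (algebraMap Z B w)) = (finrank Z B : ℚ) * Algebra.trace ℚ Z w := by
    intro w
    let b := Module.finBasis ℚ Z
    let c := Module.finBasis Z B
    have hl : LinearMap.mulLeft ℚ (algebraMap Z B w) = Algebra.lmul ℚ B (algebraMap Z B w) := LinearMap.ext fun _ => rfl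
    rw [LinearMap.trace_eq_matrix_trace ℚ (b.smulTower c), hl, ← Algebra.leftMulMatrix_apply,
      Algebra.smulTower_leftMulMatrix_algebraMap, Matrix.trace_blockDiagonal, Finset.sum_const, Finset.card_univ, Fintype.card_fin,
      ← Algebra.trace_eq_matrix_trace b w, nsmul_eq_mul]
  -- positivity of `*` read on the centre
  have htr₀ : ∀ x : Z, 0 ≤ Algebra.trace ℚ Z (x * σ x) := by
    intro x
    by_cases hx : x = 0
    · rw [hx, zero_mul, map_zero]
    · have hx' : (x : B) ≠ 0 := fun h => hx (Subtype.ext h)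
      have h1 := D.pos (x : B) hx'
      have h2 : (x : B) * star (x : B) = algebraMap Z B (x * σ x) := by rw [halg, Subalgebra.coe_mul, hσ]
      rw [h2, htrB] at h1
      exact le_of_lt ((mul_pos_iff_of_pos_left (by exact_mod_cast hBZ)).mp h1)
  have hσne : ∃ z : Z, σ z ≠ z := by
    obtain ⟨x, hx, hne⟩ := hA
    exact ⟨⟨x, hx⟩, fun h => hne (by rw [← hσ ⟨x, hx⟩, h])⟩
  /- §2 a `Type`-small copy `K ⊆ ℂ` of `F` (the real-structure engine is stated for number fields in `Type`); `K` is a totally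
  imaginary number field and `[F : ℚ] = 2 [F₀ : ℚ]` -/
  let φ : Z →+* ℂ := (IsAlgClosed.lift : Z →ₐ[ℚ] ℂ).toRingHom
  obtain ⟨K, _instK, _instCZ, ⟨e⟩⟩ : ∃ (K : Type) (_ : Field K) (_ : CharZero K), Nonempty (Z ≃+* K) :=
    ⟨↥φ.fieldRange, inferInstance, inferInstance, ⟨φ.rangeRestrictFieldEquiv⟩⟩
  let eQ : Z ≃ₐ[ℚ] K := AlgEquiv.ofRingEquiv (f := e) fun q => by
    rw [eq_ratCast (algebraMap ℚ K) q, ← eq_ratCast (e.toRingHom.comp (algebraMap ℚ Z)) q]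
    rfl
  have heQ : ∀ z : Z, eQ z = e z := fun _ => rfl
  haveI : FiniteDimensional ℚ K := LinearEquiv.finiteDimensional eQ.toLinearEquiv
  haveI : NumberField K := @NumberField.mk K _ inferInstance inferInstance
  have hKZ : finrank ℚ K = finrank ℚ Z := eQ.toLinearEquiv.finrank_eq.symm
  let σK : K →+* K := e.toRingHom.comp (σ.comp e.symm.toRingHom)
  have hσK_apply : ∀ k : K, σK k = e (σ (e.symm k)) := fun _ => rfl
  have hσK : ∀ k : K, 0 ≤ Algebra.trace ℚ K (k * σK k) := by
    intro k
    have hk : k * σK k = eQ (e.symm k * σ (e.symm k)) := by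
      rw [hσK_apply, map_mul, heQ, heQ, e.apply_symm_apply]
    rw [hk, Algebra.trace_eq_of_algEquiv]
    exact htr₀ _
  have hσKne : σK ≠ RingHom.id K := by
    obtain ⟨z, hz⟩ := hσne
    intro h
    have h1 : σK (e z) = e z := by rw [h, RingHom.id_apply]
    rw [hσK_apply, e.symm_apply_apply] at h1
    exact hz (e.injective h1)
  haveI : IsTotallyComplex K := Literature.NumberTheory.NumberFields.isTotallyComplex_of_trace_mul_nonneg σK hσK hσKne
  /- §3 `C = End_B(V)` is a finite-dimensional central simple `K`-algebra through `K ≅ F —ρ→ C` -/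
  haveI : IsSimpleRing D.C := isSimpleRing_C D
  let ιZ : Z →+* D.C :=
    { toFun := fun z => ⟨D.ρ (z : B), (rho_mem_C_iff D (z : B)).2 z.2⟩
      map_one' := Subtype.ext (by simp)
      map_mul' := fun a b => Subtype.ext (by simp)
      map_zero' := Subtype.ext (by simp)
      map_add' := fun a b => Subtype.ext (by simp) }
  have hιZ : ∀ z : Z, ((ιZ z : D.C) : Module.End ℚ V) = D.ρ (z : B) := fun _ => rfl
  let ι : K →+* D.C := ιZ.comp e.symm.toRingHom
  have hι : ∀ k : K, ((ι k : D.C) : Module.End ℚ V) = D.ρ ((e.symm k : Z) : B) := fun _ => rfl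
  have hιc : ∀ (k : K) (c : D.C), ι k * c = c * ι k := fun k c => by
    apply Subtype.ext
    have hc : (c : Module.End ℚ V) ∈ Subalgebra.centralizer ℚ (Set.range D.ρ) := c.2
    rw [Subalgebra.mem_centralizer_iff] at hc
    change (ι k : Module.End ℚ V) * c = c * (ι k : Module.End ℚ V)
    rw [hι]
    exact hc _ ⟨_, rfl⟩
  letI : Algebra K D.C := ι.toAlgebra' hιc
  have halgK : ∀ k : K, algebraMap K D.C k = ι k := fun _ => rfl
  haveI : IsScalarTower ℚ K D.C := ⟨fun q k c => by
    change ι (q • k) * c = q • (ι k * c)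
    rw [map_rat_smul ι q k, smul_mul_assoc]⟩
  haveI : Module.Finite ℚ D.C := Module.Finite.of_injective D.C.val.toLinearMap Subtype.val_injective
  haveI : Module.Finite K D.C := Module.Finite.of_restrictScalars_finite ℚ K D.C
  haveI : Algebra.IsCentral K D.C := ⟨fun c hc => by
    rw [Subalgebra.mem_center_iff] at hc
    have hc' : (c : Module.End ℚ V) ∈ (Subalgebra.center ℚ D.C).map D.C.val :=
      Subalgebra.mem_map.2 ⟨c, Subalgebra.mem_center_iff.2 hc, rfl⟩
    rw [center_C_map_val D, Subalgebra.mem_map] at hc'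
    obtain ⟨b, hb, hbc⟩ := hc'
    refine Algebra.mem_bot.2 ⟨e ⟨b, hb⟩, Subtype.ext ?_⟩
    rw [halgK, hι, e.symm_apply_apply, hbc]⟩
  /- §4 the engine: `ℝ ⊗_ℚ C ≃ₐ[ℝ] ∏_{w ∣ ∞} M_d(ℂ)`, `d = √[C : K]` -/
  obtain ⟨Φ, -, -, -⟩ := exists_algEquiv_pi_matrix (K := K) (F := D.C)
  /- §5 bookkeeping: `[C : K] = d²`, `#{w} = [F₀ : ℚ]`, `dim_ℚ C = d² [F : ℚ]` -/
  obtain ⟨d, hd⟩ := isSquare_finrank_of_isCentral K D.C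
  have hsq : Nat.sqrt (finrank K D.C) = d := by rw [hd, ← pow_two]; exact Nat.sqrt_eq' d
  have hdpos : 0 < d := by
    have h : 0 < finrank K D.C := finrank_pos
    rw [hd] at h
    exact Nat.pos_of_ne_zero fun h0 => by rw [h0, mul_zero] at h; exact lt_irrefl 0 h
  have hcard : Fintype.card (InfinitePlace K) = finrank ℚ (F0 B) := by
    have h3 : 2 * finrank ℚ (F0 B) = finrank ℚ Z := two_mul_finrank_F0 B hA
    have h2 : 2 * Fintype.card (InfinitePlace K) = finrank ℚ K := two_mul_card_infinitePlace_eq_finrank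
    have h4 : 2 * Fintype.card (InfinitePlace K) = 2 * finrank ℚ (F0 B) := by rw [h2, h3, hKZ]
    omega
  let ε : InfinitePlace K ≃ Fin (finrank ℚ (F0 B)) := Fintype.equivFinOfCardEq hcard
  have hdim : finrank ℚ D.C = d ^ 2 * finrank ℚ (Subalgebra.center ℚ B) := by
    have h5 := Module.finrank_mul_finrank ℚ K D.C
    rw [hKZ, hd] at h5
    rw [← h5, ← hZdef]
    ring
  refine ⟨d, hdpos, hdim, ⟨Φ.trans ((AlgEquiv.piCongrRight fun _ => Matrix.reindexAlgEquiv ℝ ℂ (finCongr hsq)).trans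
    (AlgEquiv.piCongrLeft' ℝ (fun _ : InfinitePlace K => Matrix (Fin d) (Fin d) ℂ) ε))⟩⟩

end Literature.NumberTheory.Kottwitz1992.ModuliProblem

end
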